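import Summits.KontsevichZagierPeriods.KontsevichZagierPeriods.Theses.SpectrahedralScissors
import Mathlib.LinearAlgebra.Matrix.PosDef
import Mathlib.Tactic.FinCases

/-!
# `FibreReflection` (stmt-KontsevichZagierPeriods-9268, route SpectrahedralScissors) — proof

PPT = central reflection on the maximally-mixed-marginal fibre.  For the real 7-parameter family
`ρ(x) = [[X, Z], [Zᵀ, ½·1 − X]]` and the complex 12-parameter family
`ρ(x) = [[X, Z], [Z*, ½·1 − X]]` of `4 × 4` states with maximally mixed second marginal, the
partially transposed matrix `ρ(x)^Γ = [[X, Zᵀ], [Z, ½·1 − X]]` (resp. `[[X, Z*], [Z, ½·1 − X]]`)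
is positive semidefinite iff `½·1 − ρ(x)` is.

Proof: with the block swap `σ = (0 2)(1 3)` of `Fin 4` and the signs `d = (1, 1, −1, −1)` one has
the entrywise identities `ρ^Γ i j = d i · (½·1 − ρ) (σ i) (σ j) · d j` and
`(½·1 − ρ) i j = d i · ρ^Γ (σ i) (σ j) · d j`, i.e. `ρ^Γ = D S (½·1 − ρ) Sᵀ D` with `S` the
block-swap permutation matrix and `D = diag d` (this uses only `X + Y = ½·1`).  Positive
semidefiniteness is stable under `M ↦ M.submatrix σ σ` (`Matrix.PosSemidef.submatrix`) and under
the congruence `M ↦ D M Dᴴ` (`Matrix.PosSemidef.mul_mul_conjTranspose_same`), which gives both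
directions of both equivalences; the sixteen entrywise identities of each direction are checked by
`fin_cases`/`simp`. (lead c10 of crux 9129, banking)
-/

namespace Summit.KontsevichZagierPeriods.SpectrahedralScissors

open Matrix
open scoped ComplexOrder

/-- **Signed relabelling preserves positive semidefiniteness.**  If `M` is positive semidefinite and
`A i j = d i * M (e i) (e j) * star (d j)` entrywise, then
`A = diagonal d * M.submatrix e e * (diagonal d)ᴴ` is positive semidefinite. [folklore] -/
theorem posSemidef_of_eq_signed_submatrix {m n R : Type*} [Fintype m] [DecidableEq m] [Fintype n]
    [CommRing R] [PartialOrder R] [StarRing R] {M : Matrix n n R} (hM : M.PosSemidef) (e : m → n)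
    (d : m → R) {A : Matrix m m R} (hA : ∀ i j, A i j = d i * M (e i) (e j) * star (d j)) :
    A.PosSemidef := by
  have h : A = diagonal d * M.submatrix e e * (diagonal d)ᴴ := by
    ext i j
    simp [hA, Matrix.mul_diagonal, Matrix.diagonal_mul, Matrix.diagonal_conjTranspose]
  rw [h]
  exact (hM.submatrix e).mul_mul_conjTranspose_same _

/-- **`FibreReflection`** (route SpectrahedralScissors, stmt-KontsevichZagierPeriods-9268): for the
real 7-parameter and the complex 12-parameter fibre parametrisations,
`ρ(x)^Γ ≽ 0 ↔ ½·1 − ρ(x) ≽ 0`.  Both directions are the signed block-swap relabelling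
`σ = (0 2)(1 3)`, `d = (1, 1, −1, −1)`: `ρ^Γ = D S (½·1 − ρ) Sᵀ D` and `½·1 − ρ = D S ρ^Γ Sᵀ D`,
and positive semidefiniteness is preserved by `posSemidef_of_eq_signed_submatrix`. [folklore] -/
theorem fibreReflection_proof :
    Summit.KontsevichZagierPeriods.KontsevichZagierPeriods.Theses.SpectrahedralScissors.FibreReflection :=
  by
  refine ⟨fun x => ⟨fun h => ?_, fun h => ?_⟩, fun x => ⟨fun h => ?_, fun h => ?_⟩⟩
  · refine posSemidef_of_eq_signed_submatrix h ![2, 3, 0, 1] ![1, 1, -1, -1] ?_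
    intro i j
    fin_cases i <;> fin_cases j <;> simp
  · refine posSemidef_of_eq_signed_submatrix h ![2, 3, 0, 1] ![1, 1, -1, -1] ?_
    intro i j
    fin_cases i <;> fin_cases j <;> simp
  · refine posSemidef_of_eq_signed_submatrix h ![2, 3, 0, 1] ![1, 1, -1, -1] ?_
    intro i j
    fin_cases i <;> fin_cases j <;> simp [Complex.ext_iff]
  · refine posSemidef_of_eq_signed_submatrix h ![2, 3, 0, 1] ![1, 1, -1, -1] ?_
    intro i j
    fin_cases i <;> fin_cases j <;> simp [Complex.ext_iff]

end Summit.KontsevichZagierPeriods.SpectrahedralScissors
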